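import Summits.BirchSwinnertonDyer.BirchSwinnertonDyer.Theorems.KatoDescentTamePotSupersingularTameUpperRankEqSplitDoors
import Summits.BirchSwinnertonDyer.BirchSwinnertonDyer.Theorems.KatoDescentTamePotSupersingularTameUpperUnitTwistRecordsFlat49
import Summits.BirchSwinnertonDyer.BirchSwinnertonDyer.Theorems.KatoDescentTamePotSupersingularTameUpperUnitTwistRecordsFlat88
import Summits.BirchSwinnertonDyer.BirchSwinnertonDyer.Theorems.KatoDescentTamePotSupersingularTameUpperUnitTwistRecordsFlat50
import Summits.BirchSwinnertonDyer.BirchSwinnertonDyer.Theorems.KatoDescentTamePotSupersingularTameUpperUnitTwistRecordsSharp39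
import Summits.BirchSwinnertonDyer.BirchSwinnertonDyer.Theorems.KatoDescentTamePotSupersingularTameUpperMuRoadFiveRecordsSplit03
import Summits.BirchSwinnertonDyer.BirchSwinnertonDyer.Theorems.KatoDescentTamePotSupersingularTameUpperUnitTwistRecordsFlat76
import Summits.BirchSwinnertonDyer.BirchSwinnertonDyer.Theorems.KatoDescentTamePotSupersingularTameUpperUnitTwistRecordsSharp42
import HarnessLib

/-!
# Route `KatoDescentTamePotSupersingular` (rung K8, sub-rung B4 (t′), cell `bsd-potss`): μ-FREE U₀ RECORDS at `p = 5` FROM THE LAYER-0 RANK EQUALITY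
# `rank_5 Cl(ℚ(P)) = rank_5 Cl(ℚ(x(P)))` — KT `5Ns` rows (index-two image G₁₆ ≅ M₁₆), part 08 (215600co1, 215600cs1, 216225bq1, 216225br1, 341775dk1, 446400hu1, 446400ma1, 446400mb1)

Seat `bsd-potss-k8t-c4` g26; `--supports stmt-BirchSwinnertonDyer-19982 --as helper`. THEOREMS ONLY (no definition, no named fact, no `sorry`);
nothing booked; (A), Conjecture A and BSD are proved for NO curve here; items 19202 / 19982 stay OPEN at class level (open inputs class-wide: zeta
crux 24439, lower half of 19984).

Per row `E` (Cremona label, `r_an = 0`, additive potentially supersingular (t′) at `5`, mod-`5` image in the normaliser of a split Cartan subgroup —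
LMFDB `5Ns`; by the seat's census kit j333447 `#Gal(ℚ(E[5])/ℚ) = 16` (`M₁₆`, SmallGroup `[16,6]`, the unique index-2 subgroup of `C_s⁺(5)` with surjective determinant acting transitively on the axis points); the image is a DISPLAYED hypothesis — the basis data):
`MissingUpperBoundAt E 5` (`ord₅ #Ш(E) ≤ ord₅ #Ш_an(E)`) from the named facts `hKatoA hGZK hmod`, Cremona's `r_an = 0`, the basis data and the ONE
class-group datum `hrank : #Cl(ℚ(P))[5] = #Cl(ℚ(x(P)))[5]` (`ℚ(P)` of degree 8 and `ℚ(x(P))` of degree 4 for an axis point `P`; BOTH class numbers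
CERTIFIED by `bnfcertify`, kit j333447); NO inertia hypothesis (automatic for `G₁₆`: every element of determinant `2` has fourth power `−1`, and `det ρ̄(I(𝔮|5)) = 𝔽₅ˣ`), through the door `TameRankEqRecords.missingUpperBoundAt_five_tame_of_splitCartanIndexTwoBasis_of_rankEq`
(k8t-c4 g26, over g25's image-agnostic rank-equality road).  KERNEL per row (tree certificates, cited by name): `E[5]` irreducible, `Addv E 5`,
`SubTprime E 5`.  These rows carried ONLY unit-twist records before (`TameUpperUnitTwistRecords`: the rank-one Heegner twist's BSD inputs displayed);
this is their first Kato-(A) road.  The numerical values are DISPLAYED HYPOTHESES, not certified in Lean.  CONDITIONAL; per row; nothing booked; BSD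
for no curve.

References: [Kato2004Asterisque] Thm. 14.5 (3); [CoatesSujatha2005] Thm. 3.4; [Iwasawa1956]; [Serre1972] §2.2, §5.2 (iii); [Cremona2006] Table 1.
-/

set_option autoImplicit false
-- the Theorems directory repeats the summit name (`Summits/BirchSwinnertonDyer/BirchSwinnertonDyer/…`): house rule of the cell
set_option linter.dupNamespace false

noncomputable section

open scoped Classical NumberField Matrix
open WeierstrassCurve Field IntermediateField
  Literature.NumberTheory.EllipticCurves Literature.NumberTheory.EllipticCurves.Rank1Residual
  Literature.NumberTheory.EllipticCurves.Rank1Residual.Typed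
  Literature.NumberTheory.GaloisRepresentations Literature.NumberTheory.SerreUniformity
  Literature.NumberTheory.IwasawaTheory
  Summit.BirchSwinnertonDyer.Rank1Residual Summit.BirchSwinnertonDyer.Rank1Residual.Additive
  Summit.BirchSwinnertonDyer.BirchSwinnertonDyer.Theorems

namespace Summit.BirchSwinnertonDyer.BirchSwinnertonDyer.Theorems.TameRankEqRecords

/-! ### `215600co1` @ `p = 5` — `N = 215600 = 2^4·5^2·7^2·11`; Cremona: `r_an = 0`; (t′) at `5` (Kodaira IV*, e = 3); ♭; image `G₁₆ ≅ M₁₆` (`#Gal = 16`, SmallGroup `[16,6]`;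
the unique index-`2` subgroup of `C_s⁺(5)` with surjective determinant acting transitively on the axis points; displayed);
layer-0 census (kit j333447): `h(ℚ(x(P))) = 1` [CERT], `h(ℚ(P)) = 2` [CERT] ⇒ `hrank`: `1 = 1`. -/

/-- **CONDITIONAL U₀ for `215600co1` @ 5 FROM THE LAYER-0 RANK EQUALITY ALONE** — `ord₅ #Ш(E) ≤ ord₅ #Ш_an(E)` (`MissingUpperBoundAt E 5`) for
`E = 215600co1 = [0, 0, 0, -140000, -14210000]` (`N = 2^4·5^2·7^2·11`), from: the named facts `hKatoA hGZK hmod`; Cremona's `r_an = 0` (`hr`); the `G₁₆` basis data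
(`e he σs σa hσs hσa`, displayed); the rank equality `#Cl(ℚ(P))[5] = #Cl(ℚ(x(P)))[5]` (`hrank`; numerically `1 = 1`: `h(ℚ(x(P))) = 1` [CERT],
`h(ℚ(P)) = 2` [CERT], kit j333447).  NO `μ`-hypothesis, NO inertia hypothesis.  KERNEL: `E[5]` irreducible, `Addv`, `SubTprime` (tree:
`TameUpperUnitTwistRecords.irr_g215600co1_5`, `addv_g215600co1_5`, `subTprime_g215600co1_5`); `σ̄_a⁴ ∈ I(𝔮|5)` automatic.  Per row; CONDITIONAL; nothing booked; BSD is not proved by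
this. [cite: Kato2004Asterisque, Thm. 14.5 (3) (p. 236)] [cite: CoatesSujatha2005, §3 Thm. 3.4] [cite: Iwasawa1956, §§3–5]
[cite: Cremona2006, Table 1 (Cremona label 215600co1)] -/
theorem missingUpperBoundAt_g215600co1_5_of_rankEq
    (hKatoA : Kato2004.rankZero_padicValNat_sha_add_padicValNat_tamagawa_le_of_additive_potGood_of_irreducible_of_fineSelmerDual_fg)
    (hGZK : rank_eq_analyticRank_of_analyticRank_le_one) (hmod : hasEntireLFunction_rat)
    {W : WeierstrassCurve ℚ} [W.IsElliptic] [W.IsGloballyMinimal] (hWeq : W = (⟨0, 0, 0, (-140000), (-14210000)⟩ : WeierstrassCurve ℚ))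
    (hr : W.analyticRank = 0)
    (e : W.geomTorsion (5 : ℕ) ≃+ (Fin 2 → ZMod 5))
    (he : ∀ σ : absoluteGaloisGroup ℚ, ∃ M ∈ splitCartanNormalizer 5, (M 1 1 = M 0 0 ∨ M 1 1 = 4 * M 0 0) ∧
      (M 1 0 = 2 * M 0 1 ∨ M 1 0 = 3 * M 0 1) ∧ ∀ P : W.geomTorsion (5 : ℕ), e (σ • P) = M *ᵥ e P)
    (σs σa : absoluteGaloisGroup ℚ) (hσs : ∀ P : W.geomTorsion (5 : ℕ), e (σs • P) = !![1, 0; 0, 4] *ᵥ e P)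
    (hσa : ∀ P : W.geomTorsion (5 : ℕ), e (σa • P) = !![0, 1; 2, 0] *ᵥ e P)
    (hrank : Nat.card {d : ClassGroup (𝓞 ↥(fixedField (Subgroup.zpowers (absRestrictNormalHom (W.divisionField 5) σs)))) // d ^ 5 = 1} =
      Nat.card {d : ClassGroup (𝓞 ↥(fixedField (Subgroup.zpowers (absRestrictNormalHom (W.divisionField 5) (σa ^ 4)) ⊔
        Subgroup.zpowers (absRestrictNormalHom (W.divisionField 5) σs)))) // d ^ 5 = 1}) :
    MissingUpperBoundAt W 5 := by
  subst hWeq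
  exact missingUpperBoundAt_five_tame_of_splitCartanIndexTwoBasis_of_rankEq _ hKatoA hGZK hmod hr
    TameUpperUnitTwistRecords.addv_g215600co1_5 TameUpperUnitTwistRecords.subTprime_g215600co1_5 TameUpperUnitTwistRecords.irr_g215600co1_5
    e he σs σa hσs hσa hrank

/-! ### `215600cs1` @ `p = 5` — `N = 215600 = 2^4·5^2·7^2·11`; Cremona: `r_an = 0`; (t′) at `5` (Kodaira IV*, e = 3); ♭; image `G₁₆ ≅ M₁₆` (`#Gal = 16`, SmallGroup `[16,6]`;
the unique index-`2` subgroup of `C_s⁺(5)` with surjective determinant acting transitively on the axis points; displayed);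
layer-0 census (kit j333447): `h(ℚ(x(P))) = 1` [CERT], `h(ℚ(P)) = 2` [CERT] ⇒ `hrank`: `1 = 1`. -/

/-- **CONDITIONAL U₀ for `215600cs1` @ 5 FROM THE LAYER-0 RANK EQUALITY ALONE** — `ord₅ #Ш(E) ≤ ord₅ #Ш_an(E)` (`MissingUpperBoundAt E 5`) for
`E = 215600cs1 = [0, 0, 0, -6860000, 4874030000]` (`N = 2^4·5^2·7^2·11`), from: the named facts `hKatoA hGZK hmod`; Cremona's `r_an = 0` (`hr`); the `G₁₆` basis data
(`e he σs σa hσs hσa`, displayed); the rank equality `#Cl(ℚ(P))[5] = #Cl(ℚ(x(P)))[5]` (`hrank`; numerically `1 = 1`: `h(ℚ(x(P))) = 1` [CERT],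
`h(ℚ(P)) = 2` [CERT], kit j333447).  NO `μ`-hypothesis, NO inertia hypothesis.  KERNEL: `E[5]` irreducible, `Addv`, `SubTprime` (tree:
`TameUpperUnitTwistRecords.irr_g215600cs1_5`, `addv_g215600cs1_5`, `subTprime_g215600cs1_5`); `σ̄_a⁴ ∈ I(𝔮|5)` automatic.  Per row; CONDITIONAL; nothing booked; BSD is not proved by
this. [cite: Kato2004Asterisque, Thm. 14.5 (3) (p. 236)] [cite: CoatesSujatha2005, §3 Thm. 3.4] [cite: Iwasawa1956, §§3–5]
[cite: Cremona2006, Table 1 (Cremona label 215600cs1)] -/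
theorem missingUpperBoundAt_g215600cs1_5_of_rankEq
    (hKatoA : Kato2004.rankZero_padicValNat_sha_add_padicValNat_tamagawa_le_of_additive_potGood_of_irreducible_of_fineSelmerDual_fg)
    (hGZK : rank_eq_analyticRank_of_analyticRank_le_one) (hmod : hasEntireLFunction_rat)
    {W : WeierstrassCurve ℚ} [W.IsElliptic] [W.IsGloballyMinimal] (hWeq : W = (⟨0, 0, 0, (-6860000), 4874030000⟩ : WeierstrassCurve ℚ))
    (hr : W.analyticRank = 0)
    (e : W.geomTorsion (5 : ℕ) ≃+ (Fin 2 → ZMod 5))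
    (he : ∀ σ : absoluteGaloisGroup ℚ, ∃ M ∈ splitCartanNormalizer 5, (M 1 1 = M 0 0 ∨ M 1 1 = 4 * M 0 0) ∧
      (M 1 0 = 2 * M 0 1 ∨ M 1 0 = 3 * M 0 1) ∧ ∀ P : W.geomTorsion (5 : ℕ), e (σ • P) = M *ᵥ e P)
    (σs σa : absoluteGaloisGroup ℚ) (hσs : ∀ P : W.geomTorsion (5 : ℕ), e (σs • P) = !![1, 0; 0, 4] *ᵥ e P)
    (hσa : ∀ P : W.geomTorsion (5 : ℕ), e (σa • P) = !![0, 1; 2, 0] *ᵥ e P)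
    (hrank : Nat.card {d : ClassGroup (𝓞 ↥(fixedField (Subgroup.zpowers (absRestrictNormalHom (W.divisionField 5) σs)))) // d ^ 5 = 1} =
      Nat.card {d : ClassGroup (𝓞 ↥(fixedField (Subgroup.zpowers (absRestrictNormalHom (W.divisionField 5) (σa ^ 4)) ⊔
        Subgroup.zpowers (absRestrictNormalHom (W.divisionField 5) σs)))) // d ^ 5 = 1}) :
    MissingUpperBoundAt W 5 := by
  subst hWeq
  exact missingUpperBoundAt_five_tame_of_splitCartanIndexTwoBasis_of_rankEq _ hKatoA hGZK hmod hr
    TameUpperUnitTwistRecords.addv_g215600cs1_5 TameUpperUnitTwistRecords.subTprime_g215600cs1_5 TameUpperUnitTwistRecords.irr_g215600cs1_5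
    e he σs σa hσs hσa hrank

/-! ### `216225bq1` @ `p = 5` — `N = 216225 = 3^2·5^2·31^2`; Cremona: `r_an = 0`; (t′) at `5` (Kodaira II, e = 6); ♭; image `G₁₆ ≅ M₁₆` (`#Gal = 16`, SmallGroup `[16,6]`;
the unique index-`2` subgroup of `C_s⁺(5)` with surjective determinant acting transitively on the axis points; displayed);
layer-0 census (kit j333447): `h(ℚ(x(P))) = 1` [CERT], `h(ℚ(P)) = 8` [CERT] ⇒ `hrank`: `1 = 1`. -/

/-- **CONDITIONAL U₀ for `216225bq1` @ 5 FROM THE LAYER-0 RANK EQUALITY ALONE** — `ord₅ #Ш(E) ≤ ord₅ #Ш_an(E)` (`MissingUpperBoundAt E 5`) for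
`E = 216225bq1 = [0, 0, 1, -24649650, -46796484814]` (`N = 3^2·5^2·31^2`), from: the named facts `hKatoA hGZK hmod`; Cremona's `r_an = 0` (`hr`); the `G₁₆` basis data
(`e he σs σa hσs hσa`, displayed); the rank equality `#Cl(ℚ(P))[5] = #Cl(ℚ(x(P)))[5]` (`hrank`; numerically `1 = 1`: `h(ℚ(x(P))) = 1` [CERT],
`h(ℚ(P)) = 8` [CERT], kit j333447).  NO `μ`-hypothesis, NO inertia hypothesis.  KERNEL: `E[5]` irreducible, `Addv`, `SubTprime` (tree:
`TameUpperUnitTwistRecords.irr_g216225bq1_5`, `addv_g216225bq1_5`, `subTprime_g216225bq1_5`); `σ̄_a⁴ ∈ I(𝔮|5)` automatic.  Per row; CONDITIONAL; nothing booked; BSD is not proved by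
this. [cite: Kato2004Asterisque, Thm. 14.5 (3) (p. 236)] [cite: CoatesSujatha2005, §3 Thm. 3.4] [cite: Iwasawa1956, §§3–5]
[cite: Cremona2006, Table 1 (Cremona label 216225bq1)] -/
theorem missingUpperBoundAt_g216225bq1_5_of_rankEq
    (hKatoA : Kato2004.rankZero_padicValNat_sha_add_padicValNat_tamagawa_le_of_additive_potGood_of_irreducible_of_fineSelmerDual_fg)
    (hGZK : rank_eq_analyticRank_of_analyticRank_le_one) (hmod : hasEntireLFunction_rat)
    {W : WeierstrassCurve ℚ} [W.IsElliptic] [W.IsGloballyMinimal] (hWeq : W = (⟨0, 0, 1, (-24649650), (-46796484814)⟩ : WeierstrassCurve ℚ))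
    (hr : W.analyticRank = 0)
    (e : W.geomTorsion (5 : ℕ) ≃+ (Fin 2 → ZMod 5))
    (he : ∀ σ : absoluteGaloisGroup ℚ, ∃ M ∈ splitCartanNormalizer 5, (M 1 1 = M 0 0 ∨ M 1 1 = 4 * M 0 0) ∧
      (M 1 0 = 2 * M 0 1 ∨ M 1 0 = 3 * M 0 1) ∧ ∀ P : W.geomTorsion (5 : ℕ), e (σ • P) = M *ᵥ e P)
    (σs σa : absoluteGaloisGroup ℚ) (hσs : ∀ P : W.geomTorsion (5 : ℕ), e (σs • P) = !![1, 0; 0, 4] *ᵥ e P)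
    (hσa : ∀ P : W.geomTorsion (5 : ℕ), e (σa • P) = !![0, 1; 2, 0] *ᵥ e P)
    (hrank : Nat.card {d : ClassGroup (𝓞 ↥(fixedField (Subgroup.zpowers (absRestrictNormalHom (W.divisionField 5) σs)))) // d ^ 5 = 1} =
      Nat.card {d : ClassGroup (𝓞 ↥(fixedField (Subgroup.zpowers (absRestrictNormalHom (W.divisionField 5) (σa ^ 4)) ⊔
        Subgroup.zpowers (absRestrictNormalHom (W.divisionField 5) σs)))) // d ^ 5 = 1}) :
    MissingUpperBoundAt W 5 := by
  subst hWeq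
  exact missingUpperBoundAt_five_tame_of_splitCartanIndexTwoBasis_of_rankEq _ hKatoA hGZK hmod hr
    TameUpperUnitTwistRecords.addv_g216225bq1_5 TameUpperUnitTwistRecords.subTprime_g216225bq1_5 TameUpperUnitTwistRecords.irr_g216225bq1_5
    e he σs σa hσs hσa hrank

/-! ### `216225br1` @ `p = 5` — `N = 216225 = 3^2·5^2·31^2`; Cremona: `r_an = 0`; (t′) at `5` (Kodaira II, e = 6); ♭; image `G₁₆ ≅ M₁₆` (`#Gal = 16`, SmallGroup `[16,6]`;
the unique index-`2` subgroup of `C_s⁺(5)` with surjective determinant acting transitively on the axis points; displayed);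
layer-0 census (kit j333447): `h(ℚ(x(P))) = 1` [CERT], `h(ℚ(P)) = 8` [CERT] ⇒ `hrank`: `1 = 1`. -/

/-- **CONDITIONAL U₀ for `216225br1` @ 5 FROM THE LAYER-0 RANK EQUALITY ALONE** — `ord₅ #Ш(E) ≤ ord₅ #Ш_an(E)` (`MissingUpperBoundAt E 5`) for
`E = 216225br1 = [0, 0, 1, -2738850, 1733203141]` (`N = 3^2·5^2·31^2`), from: the named facts `hKatoA hGZK hmod`; Cremona's `r_an = 0` (`hr`); the `G₁₆` basis data
(`e he σs σa hσs hσa`, displayed); the rank equality `#Cl(ℚ(P))[5] = #Cl(ℚ(x(P)))[5]` (`hrank`; numerically `1 = 1`: `h(ℚ(x(P))) = 1` [CERT],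
`h(ℚ(P)) = 8` [CERT], kit j333447).  NO `μ`-hypothesis, NO inertia hypothesis.  KERNEL: `E[5]` irreducible, `Addv`, `SubTprime` (tree:
`TameUpperUnitTwistRecords.irr_g216225br1_5`, `addv_g216225br1_5`, `subTprime_g216225br1_5`); `σ̄_a⁴ ∈ I(𝔮|5)` automatic.  Per row; CONDITIONAL; nothing booked; BSD is not proved by
this. [cite: Kato2004Asterisque, Thm. 14.5 (3) (p. 236)] [cite: CoatesSujatha2005, §3 Thm. 3.4] [cite: Iwasawa1956, §§3–5]
[cite: Cremona2006, Table 1 (Cremona label 216225br1)] -/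
theorem missingUpperBoundAt_g216225br1_5_of_rankEq
    (hKatoA : Kato2004.rankZero_padicValNat_sha_add_padicValNat_tamagawa_le_of_additive_potGood_of_irreducible_of_fineSelmerDual_fg)
    (hGZK : rank_eq_analyticRank_of_analyticRank_le_one) (hmod : hasEntireLFunction_rat)
    {W : WeierstrassCurve ℚ} [W.IsElliptic] [W.IsGloballyMinimal] (hWeq : W = (⟨0, 0, 1, (-2738850), 1733203141⟩ : WeierstrassCurve ℚ))
    (hr : W.analyticRank = 0)
    (e : W.geomTorsion (5 : ℕ) ≃+ (Fin 2 → ZMod 5))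
    (he : ∀ σ : absoluteGaloisGroup ℚ, ∃ M ∈ splitCartanNormalizer 5, (M 1 1 = M 0 0 ∨ M 1 1 = 4 * M 0 0) ∧
      (M 1 0 = 2 * M 0 1 ∨ M 1 0 = 3 * M 0 1) ∧ ∀ P : W.geomTorsion (5 : ℕ), e (σ • P) = M *ᵥ e P)
    (σs σa : absoluteGaloisGroup ℚ) (hσs : ∀ P : W.geomTorsion (5 : ℕ), e (σs • P) = !![1, 0; 0, 4] *ᵥ e P)
    (hσa : ∀ P : W.geomTorsion (5 : ℕ), e (σa • P) = !![0, 1; 2, 0] *ᵥ e P)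
    (hrank : Nat.card {d : ClassGroup (𝓞 ↥(fixedField (Subgroup.zpowers (absRestrictNormalHom (W.divisionField 5) σs)))) // d ^ 5 = 1} =
      Nat.card {d : ClassGroup (𝓞 ↥(fixedField (Subgroup.zpowers (absRestrictNormalHom (W.divisionField 5) (σa ^ 4)) ⊔
        Subgroup.zpowers (absRestrictNormalHom (W.divisionField 5) σs)))) // d ^ 5 = 1}) :
    MissingUpperBoundAt W 5 := by
  subst hWeq
  exact missingUpperBoundAt_five_tame_of_splitCartanIndexTwoBasis_of_rankEq _ hKatoA hGZK hmod hr
    TameUpperUnitTwistRecords.addv_g216225br1_5 TameUpperUnitTwistRecords.subTprime_g216225br1_5 TameUpperUnitTwistRecords.irr_g216225br1_5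
    e he σs σa hσs hσa hrank

/-! ### `341775dk1` @ `p = 5` — `N = 341775 = 3^2·5^2·7^2·31`; Cremona: `r_an = 0`; (t′) at `5` (Kodaira IV*, e = 3); ♯; image `G₁₆ ≅ M₁₆` (`#Gal = 16`, SmallGroup `[16,6]`;
the unique index-`2` subgroup of `C_s⁺(5)` with surjective determinant acting transitively on the axis points; displayed);
layer-0 census (kit j333447): `h(ℚ(x(P))) = 1` [CERT], `h(ℚ(P)) = 2` [CERT] ⇒ `hrank`: `1 = 1`. -/

/-- **CONDITIONAL U₀ for `341775dk1` @ 5 FROM THE LAYER-0 RANK EQUALITY ALONE** — `ord₅ #Ш(E) ≤ ord₅ #Ш_an(E)` (`MissingUpperBoundAt E 5`) for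
`E = 341775dk1 = [0, 0, 1, -31421250, -67349175469]` (`N = 3^2·5^2·7^2·31`), from: the named facts `hKatoA hGZK hmod`; Cremona's `r_an = 0` (`hr`); the `G₁₆` basis data
(`e he σs σa hσs hσa`, displayed); the rank equality `#Cl(ℚ(P))[5] = #Cl(ℚ(x(P)))[5]` (`hrank`; numerically `1 = 1`: `h(ℚ(x(P))) = 1` [CERT],
`h(ℚ(P)) = 2` [CERT], kit j333447).  NO `μ`-hypothesis, NO inertia hypothesis.  KERNEL: `E[5]` irreducible, `Addv`, `SubTprime` (tree:
`TameUpperUnitTwistRecords.irr_g341775dk1_5`, `addv_g341775dk1_5`, `subTprime_g341775dk1_5`); `σ̄_a⁴ ∈ I(𝔮|5)` automatic.  Per row; CONDITIONAL; nothing booked; BSD is not proved by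
this. [cite: Kato2004Asterisque, Thm. 14.5 (3) (p. 236)] [cite: CoatesSujatha2005, §3 Thm. 3.4] [cite: Iwasawa1956, §§3–5]
[cite: Cremona2006, Table 1 (Cremona label 341775dk1)] -/
theorem missingUpperBoundAt_g341775dk1_5_of_rankEq
    (hKatoA : Kato2004.rankZero_padicValNat_sha_add_padicValNat_tamagawa_le_of_additive_potGood_of_irreducible_of_fineSelmerDual_fg)
    (hGZK : rank_eq_analyticRank_of_analyticRank_le_one) (hmod : hasEntireLFunction_rat)
    {W : WeierstrassCurve ℚ} [W.IsElliptic] [W.IsGloballyMinimal] (hWeq : W = (⟨0, 0, 1, (-31421250), (-67349175469)⟩ : WeierstrassCurve ℚ))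
    (hr : W.analyticRank = 0)
    (e : W.geomTorsion (5 : ℕ) ≃+ (Fin 2 → ZMod 5))
    (he : ∀ σ : absoluteGaloisGroup ℚ, ∃ M ∈ splitCartanNormalizer 5, (M 1 1 = M 0 0 ∨ M 1 1 = 4 * M 0 0) ∧
      (M 1 0 = 2 * M 0 1 ∨ M 1 0 = 3 * M 0 1) ∧ ∀ P : W.geomTorsion (5 : ℕ), e (σ • P) = M *ᵥ e P)
    (σs σa : absoluteGaloisGroup ℚ) (hσs : ∀ P : W.geomTorsion (5 : ℕ), e (σs • P) = !![1, 0; 0, 4] *ᵥ e P)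
    (hσa : ∀ P : W.geomTorsion (5 : ℕ), e (σa • P) = !![0, 1; 2, 0] *ᵥ e P)
    (hrank : Nat.card {d : ClassGroup (𝓞 ↥(fixedField (Subgroup.zpowers (absRestrictNormalHom (W.divisionField 5) σs)))) // d ^ 5 = 1} =
      Nat.card {d : ClassGroup (𝓞 ↥(fixedField (Subgroup.zpowers (absRestrictNormalHom (W.divisionField 5) (σa ^ 4)) ⊔
        Subgroup.zpowers (absRestrictNormalHom (W.divisionField 5) σs)))) // d ^ 5 = 1}) :
    MissingUpperBoundAt W 5 := by
  subst hWeq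
  exact missingUpperBoundAt_five_tame_of_splitCartanIndexTwoBasis_of_rankEq _ hKatoA hGZK hmod hr
    TameUpperUnitTwistRecords.addv_g341775dk1_5 TameUpperUnitTwistRecords.subTprime_g341775dk1_5 TameUpperUnitTwistRecords.irr_g341775dk1_5
    e he σs σa hσs hσa hrank

/-! ### `446400hu1` @ `p = 5` — `N = 446400 = 2^6·3^2·5^2·31`; Cremona: `r_an = 0`; (t′) at `5` (Kodaira IV*, e = 3); ♭; image `G₁₆ ≅ M₁₆` (`#Gal = 16`, SmallGroup `[16,6]`;
the unique index-`2` subgroup of `C_s⁺(5)` with surjective determinant acting transitively on the axis points; displayed);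
layer-0 census (kit j333447): `h(ℚ(x(P))) = 1` [CERT], `h(ℚ(P)) = 2` [CERT] ⇒ `hrank`: `1 = 1`. -/

/-- **CONDITIONAL U₀ for `446400hu1` @ 5 FROM THE LAYER-0 RANK EQUALITY ALONE** — `ord₅ #Ш(E) ≤ ord₅ #Ш_an(E)` (`MissingUpperBoundAt E 5`) for
`E = 446400hu1 = [0, 0, 0, -2565000, 1570826250]` (`N = 2^6·3^2·5^2·31`), from: the named facts `hKatoA hGZK hmod`; Cremona's `r_an = 0` (`hr`); the `G₁₆` basis data
(`e he σs σa hσs hσa`, displayed); the rank equality `#Cl(ℚ(P))[5] = #Cl(ℚ(x(P)))[5]` (`hrank`; numerically `1 = 1`: `h(ℚ(x(P))) = 1` [CERT],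
`h(ℚ(P)) = 2` [CERT], kit j333447).  NO `μ`-hypothesis, NO inertia hypothesis.  KERNEL: `E[5]` irreducible, `Addv`, `SubTprime` (tree:
`TameConjAFiveRecords.irr_g446400hu1_5`, `addv_g446400hu1_5`, `subTprime_g446400hu1_5`); `σ̄_a⁴ ∈ I(𝔮|5)` automatic.  Per row; CONDITIONAL; nothing booked; BSD is not proved by
this. [cite: Kato2004Asterisque, Thm. 14.5 (3) (p. 236)] [cite: CoatesSujatha2005, §3 Thm. 3.4] [cite: Iwasawa1956, §§3–5]
[cite: Cremona2006, Table 1 (Cremona label 446400hu1)] -/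
theorem missingUpperBoundAt_g446400hu1_5_of_rankEq
    (hKatoA : Kato2004.rankZero_padicValNat_sha_add_padicValNat_tamagawa_le_of_additive_potGood_of_irreducible_of_fineSelmerDual_fg)
    (hGZK : rank_eq_analyticRank_of_analyticRank_le_one) (hmod : hasEntireLFunction_rat)
    {W : WeierstrassCurve ℚ} [W.IsElliptic] [W.IsGloballyMinimal] (hWeq : W = (⟨0, 0, 0, (-2565000), 1570826250⟩ : WeierstrassCurve ℚ))
    (hr : W.analyticRank = 0)
    (e : W.geomTorsion (5 : ℕ) ≃+ (Fin 2 → ZMod 5))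
    (he : ∀ σ : absoluteGaloisGroup ℚ, ∃ M ∈ splitCartanNormalizer 5, (M 1 1 = M 0 0 ∨ M 1 1 = 4 * M 0 0) ∧
      (M 1 0 = 2 * M 0 1 ∨ M 1 0 = 3 * M 0 1) ∧ ∀ P : W.geomTorsion (5 : ℕ), e (σ • P) = M *ᵥ e P)
    (σs σa : absoluteGaloisGroup ℚ) (hσs : ∀ P : W.geomTorsion (5 : ℕ), e (σs • P) = !![1, 0; 0, 4] *ᵥ e P)
    (hσa : ∀ P : W.geomTorsion (5 : ℕ), e (σa • P) = !![0, 1; 2, 0] *ᵥ e P)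
    (hrank : Nat.card {d : ClassGroup (𝓞 ↥(fixedField (Subgroup.zpowers (absRestrictNormalHom (W.divisionField 5) σs)))) // d ^ 5 = 1} =
      Nat.card {d : ClassGroup (𝓞 ↥(fixedField (Subgroup.zpowers (absRestrictNormalHom (W.divisionField 5) (σa ^ 4)) ⊔
        Subgroup.zpowers (absRestrictNormalHom (W.divisionField 5) σs)))) // d ^ 5 = 1}) :
    MissingUpperBoundAt W 5 := by
  subst hWeq
  exact missingUpperBoundAt_five_tame_of_splitCartanIndexTwoBasis_of_rankEq _ hKatoA hGZK hmod hr
    TameConjAFiveRecords.addv_g446400hu1_5 TameConjAFiveRecords.subTprime_g446400hu1_5 TameConjAFiveRecords.irr_g446400hu1_5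
    e he σs σa hσs hσa hrank

/-! ### `446400ma1` @ `p = 5` — `N = 446400 = 2^6·3^2·5^2·31`; Cremona: `r_an = 0`; (t′) at `5` (Kodaira IV*, e = 3); ♭; image `G₁₆ ≅ M₁₆` (`#Gal = 16`, SmallGroup `[16,6]`;
the unique index-`2` subgroup of `C_s⁺(5)` with surjective determinant acting transitively on the axis points; displayed);
layer-0 census (kit j333447): `h(ℚ(x(P))) = 1` [CERT], `h(ℚ(P)) = 2` [CERT] ⇒ `hrank`: `1 = 1`. -/

/-- **CONDITIONAL U₀ for `446400ma1` @ 5 FROM THE LAYER-0 RANK EQUALITY ALONE** — `ord₅ #Ш(E) ≤ ord₅ #Ш_an(E)` (`MissingUpperBoundAt E 5`) for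
`E = 446400ma1 = [0, 0, 0, -285000, -58178750]` (`N = 2^6·3^2·5^2·31`), from: the named facts `hKatoA hGZK hmod`; Cremona's `r_an = 0` (`hr`); the `G₁₆` basis data
(`e he σs σa hσs hσa`, displayed); the rank equality `#Cl(ℚ(P))[5] = #Cl(ℚ(x(P)))[5]` (`hrank`; numerically `1 = 1`: `h(ℚ(x(P))) = 1` [CERT],
`h(ℚ(P)) = 2` [CERT], kit j333447).  NO `μ`-hypothesis, NO inertia hypothesis.  KERNEL: `E[5]` irreducible, `Addv`, `SubTprime` (tree:
`TameUpperUnitTwistRecords.irr_g446400ma1_5`, `addv_g446400ma1_5`, `subTprime_g446400ma1_5`); `σ̄_a⁴ ∈ I(𝔮|5)` automatic.  Per row; CONDITIONAL; nothing booked; BSD is not proved by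
this. [cite: Kato2004Asterisque, Thm. 14.5 (3) (p. 236)] [cite: CoatesSujatha2005, §3 Thm. 3.4] [cite: Iwasawa1956, §§3–5]
[cite: Cremona2006, Table 1 (Cremona label 446400ma1)] -/
theorem missingUpperBoundAt_g446400ma1_5_of_rankEq
    (hKatoA : Kato2004.rankZero_padicValNat_sha_add_padicValNat_tamagawa_le_of_additive_potGood_of_irreducible_of_fineSelmerDual_fg)
    (hGZK : rank_eq_analyticRank_of_analyticRank_le_one) (hmod : hasEntireLFunction_rat)
    {W : WeierstrassCurve ℚ} [W.IsElliptic] [W.IsGloballyMinimal] (hWeq : W = (⟨0, 0, 0, (-285000), (-58178750)⟩ : WeierstrassCurve ℚ))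
    (hr : W.analyticRank = 0)
    (e : W.geomTorsion (5 : ℕ) ≃+ (Fin 2 → ZMod 5))
    (he : ∀ σ : absoluteGaloisGroup ℚ, ∃ M ∈ splitCartanNormalizer 5, (M 1 1 = M 0 0 ∨ M 1 1 = 4 * M 0 0) ∧
      (M 1 0 = 2 * M 0 1 ∨ M 1 0 = 3 * M 0 1) ∧ ∀ P : W.geomTorsion (5 : ℕ), e (σ • P) = M *ᵥ e P)
    (σs σa : absoluteGaloisGroup ℚ) (hσs : ∀ P : W.geomTorsion (5 : ℕ), e (σs • P) = !![1, 0; 0, 4] *ᵥ e P)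
    (hσa : ∀ P : W.geomTorsion (5 : ℕ), e (σa • P) = !![0, 1; 2, 0] *ᵥ e P)
    (hrank : Nat.card {d : ClassGroup (𝓞 ↥(fixedField (Subgroup.zpowers (absRestrictNormalHom (W.divisionField 5) σs)))) // d ^ 5 = 1} =
      Nat.card {d : ClassGroup (𝓞 ↥(fixedField (Subgroup.zpowers (absRestrictNormalHom (W.divisionField 5) (σa ^ 4)) ⊔
        Subgroup.zpowers (absRestrictNormalHom (W.divisionField 5) σs)))) // d ^ 5 = 1}) :
    MissingUpperBoundAt W 5 := by
  subst hWeq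
  exact missingUpperBoundAt_five_tame_of_splitCartanIndexTwoBasis_of_rankEq _ hKatoA hGZK hmod hr
    TameUpperUnitTwistRecords.addv_g446400ma1_5 TameUpperUnitTwistRecords.subTprime_g446400ma1_5 TameUpperUnitTwistRecords.irr_g446400ma1_5
    e he σs σa hσs hσa hrank

/-! ### `446400mb1` @ `p = 5` — `N = 446400 = 2^6·3^2·5^2·31`; Cremona: `r_an = 0`; (t′) at `5` (Kodaira IV*, e = 3); ♯; image `G₁₆ ≅ M₁₆` (`#Gal = 16`, SmallGroup `[16,6]`;
the unique index-`2` subgroup of `C_s⁺(5)` with surjective determinant acting transitively on the axis points; displayed);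
layer-0 census (kit j333447): `h(ℚ(x(P))) = 1` [CERT], `h(ℚ(P)) = 2` [CERT] ⇒ `hrank`: `1 = 1`. -/

/-- **CONDITIONAL U₀ for `446400mb1` @ 5 FROM THE LAYER-0 RANK EQUALITY ALONE** — `ord₅ #Ш(E) ≤ ord₅ #Ш_an(E)` (`MissingUpperBoundAt E 5`) for
`E = 446400mb1 = [0, 0, 0, -2565000, -1570826250]` (`N = 2^6·3^2·5^2·31`), from: the named facts `hKatoA hGZK hmod`; Cremona's `r_an = 0` (`hr`); the `G₁₆` basis data
(`e he σs σa hσs hσa`, displayed); the rank equality `#Cl(ℚ(P))[5] = #Cl(ℚ(x(P)))[5]` (`hrank`; numerically `1 = 1`: `h(ℚ(x(P))) = 1` [CERT],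
`h(ℚ(P)) = 2` [CERT], kit j333447).  NO `μ`-hypothesis, NO inertia hypothesis.  KERNEL: `E[5]` irreducible, `Addv`, `SubTprime` (tree:
`TameUpperUnitTwistRecords.irr_g446400mb1_5`, `addv_g446400mb1_5`, `subTprime_g446400mb1_5`); `σ̄_a⁴ ∈ I(𝔮|5)` automatic.  Per row; CONDITIONAL; nothing booked; BSD is not proved by
this. [cite: Kato2004Asterisque, Thm. 14.5 (3) (p. 236)] [cite: CoatesSujatha2005, §3 Thm. 3.4] [cite: Iwasawa1956, §§3–5]
[cite: Cremona2006, Table 1 (Cremona label 446400mb1)] -/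
theorem missingUpperBoundAt_g446400mb1_5_of_rankEq
    (hKatoA : Kato2004.rankZero_padicValNat_sha_add_padicValNat_tamagawa_le_of_additive_potGood_of_irreducible_of_fineSelmerDual_fg)
    (hGZK : rank_eq_analyticRank_of_analyticRank_le_one) (hmod : hasEntireLFunction_rat)
    {W : WeierstrassCurve ℚ} [W.IsElliptic] [W.IsGloballyMinimal] (hWeq : W = (⟨0, 0, 0, (-2565000), (-1570826250)⟩ : WeierstrassCurve ℚ))
    (hr : W.analyticRank = 0)
    (e : W.geomTorsion (5 : ℕ) ≃+ (Fin 2 → ZMod 5))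
    (he : ∀ σ : absoluteGaloisGroup ℚ, ∃ M ∈ splitCartanNormalizer 5, (M 1 1 = M 0 0 ∨ M 1 1 = 4 * M 0 0) ∧
      (M 1 0 = 2 * M 0 1 ∨ M 1 0 = 3 * M 0 1) ∧ ∀ P : W.geomTorsion (5 : ℕ), e (σ • P) = M *ᵥ e P)
    (σs σa : absoluteGaloisGroup ℚ) (hσs : ∀ P : W.geomTorsion (5 : ℕ), e (σs • P) = !![1, 0; 0, 4] *ᵥ e P)
    (hσa : ∀ P : W.geomTorsion (5 : ℕ), e (σa • P) = !![0, 1; 2, 0] *ᵥ e P)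
    (hrank : Nat.card {d : ClassGroup (𝓞 ↥(fixedField (Subgroup.zpowers (absRestrictNormalHom (W.divisionField 5) σs)))) // d ^ 5 = 1} =
      Nat.card {d : ClassGroup (𝓞 ↥(fixedField (Subgroup.zpowers (absRestrictNormalHom (W.divisionField 5) (σa ^ 4)) ⊔
        Subgroup.zpowers (absRestrictNormalHom (W.divisionField 5) σs)))) // d ^ 5 = 1}) :
    MissingUpperBoundAt W 5 := by
  subst hWeq
  exact missingUpperBoundAt_five_tame_of_splitCartanIndexTwoBasis_of_rankEq _ hKatoA hGZK hmod hr
    TameUpperUnitTwistRecords.addv_g446400mb1_5 TameUpperUnitTwistRecords.subTprime_g446400mb1_5 TameUpperUnitTwistRecords.irr_g446400mb1_5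
    e he σs σa hσs hσa hrank

end Summit.BirchSwinnertonDyer.BirchSwinnertonDyer.Theorems.TameRankEqRecords

end
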